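import Literature.AlgebraicGeometry.Resolution.AbhyankarValuationsLocalUniformization
import Mathlib.FieldTheory.PurelyInseparable.Exponent
import Mathlib.FieldTheory.Perfect
import HarnessLib

/-!
# Local uniformization over perfect fields reduces to `μ_p`-torsors (Temkin 2013, Rem. 1.3.5)

Topic: `Literature/AlgebraicGeometry/Resolution`. A REPRODUCTION (typed and proved, modulo the
named fact `Temkin2013`) of

* M. Temkin, *Inseparable local uniformization*, J. Algebra 373 (2013) 65–119
  (arXiv:0804.1554v3), **Remark 1.3.5 (ii)–(iii)**, p. 4 of the arXiv version:
  "(ii) … Assume that `[k:k^p]` is finite. Then there exists a tower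
  `K = K_m ⊃ … ⊃ L^{p^n} = K_0` such that each `K_i = K_{i-1}(a_i^{1/p})` is purely inseparable of
  degree `p` over `K_{i-1}`. Set `K°_i = K° ∩ K_i`. By (i), `K°_0` is locally uniformized by a regular
  scheme `X_0 = Spec(A_0)` (isomorphic to `Nr_L(X')`). … If we know how to uniformize valuations
  on `μ_p`-torsors over regular schemes, then we can uniformize `K°_1`, and proceeding inductively
  to `K°_2`, etc., we would uniformize the original `K°`. (iii) Thus, Theorem 1.3.2 implies that
  local uniformization would follow from local uniformization of hypersurfaces in `𝔸^{d+1}` given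
  by equations of the form `t^p = f(x_1, …, x_d)`."

## What is reproduced, and in which form

Over a PERFECT ground field `k` of characteristic `p` (the case `[k:k^p] = 1` of the remark; then
`L^{p^n} ⊇ k^{p^n} = k`, so every field of the tower is a `k`-extension and "local uniformization"
keeps its ground field), in the weak vocabulary `IsLocallyUniformizable` of
`LocalUniformization.lean`:

* `MuPTorsorLocalUniformization p` — the HYPOTHESIS of the remark, "valuations on `μ_p`-torsors
  over regular (uniformized) models can be uniformized", rendered field-theoretically and exactly
  as it is used in the induction: for `k` perfect of characteristic `p`, an extension `K/k`, a
  valuation ring `O` of `K`, an intermediate field `K₀` and `a ∈ K` with `a^p ∈ K₀`: if `O ∩ K₀` is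
  locally uniformizable over `k`, so is `O ∩ K₀(a)`. (`K₀(a)/K₀` is purely inseparable of degree
  `1` or `p`; the generic fibre of the `μ_p`-torsor `Spec A₀[t]/(t^p - a₁) → Spec A₀` of the remark,
  `a₁ = a·c^p ∈ A₀`, is `K₀(a)`; every valuation ring of `K₀(a)` is `O ∩ K₀(a)` for a valuation
  ring `O` of any given overfield `K`, by Chevalley's extension theorem, so quantifying over `O` of
  `K` loses nothing.)
* `LocalUniformizationPerfectInChar p` — local uniformization (`LocalUniformizationInChar p` of
  `LocalUniformization.lean`) restricted to perfect ground fields.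
* `MuPTorsorLocalUniformization.localUniformizationPerfect` — **the remark**:
  `Temkin2013 → MuPTorsorLocalUniformization p → LocalUniformizationPerfectInChar p` (`p` prime).
  Proof = the remark's: Temkin's finite purely inseparable `L/K` with `L°` uniformized; `n` with
  `L^{p^n} ⊆ K` (`IsPurelyInseparable.exponent`); the `n`-th Frobenius `L ≅ L^{p^n} = K₀ ⊆ K` is a
  ring isomorphism, `σ`-semilinear over `k` for `σ = Frob^n ∈ Aut(k)` (perfectness), carrying `L°`
  onto `O ∩ K₀` — so `O ∩ K₀` is uniformized (`IsLocallyUniformizable.of_ringEquiv`, transport of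
  an affine model along a semilinear field isomorphism); then climb from `K₀` to `K = K₀(t₁,…,t_m)`
  (`t_j` the generators of `K/k`, `t_j^{p^n} ∈ K₀`) adjoining one `p`-th root at a time
  (`muPTorsor_tower`).
* `MuPTorsorStepsAt p k O` — the same hypothesis AT ONE ambient valuation ring `O` of `K ⊇ k`
  (all torsor steps `K₀ ⊆ K₀(a^{1/p}) ⊆ K` for the restrictions of this `O`), and
  `isLocallyUniformizable_of_muPTorsorStepsAt` — the remark valuation by valuation: the induction of
  (ii) only ever uses the torsor hypothesis for the restrictions `K° ∩ K_i` of the one valuation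
  ring `K°` being uniformized. Consequently (`localUniformizationPerfectInChar_iff_posDefect`) the
  torsor hypothesis is only NEEDED at valuations of POSITIVE transcendence defect: Abhyankar
  valuations over perfect fields are uniformized outright by Knaf–Kuhlmann 2005, Thm. 1.1 (tree:
  `isLocallyUniformizable_of_transcendenceDefect_eq_zero`).
* The converse `LocalUniformizationPerfectInChar p → MuPTorsorLocalUniformization p` and the
  restriction `LocalUniformizationInChar p → LocalUniformizationPerfectInChar p` are trivial and
  recorded, so that over perfect fields local uniformization is EQUIVALENT to its `μ_p`-torsor
  case (`localUniformizationPerfectInChar_iff`).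

Not reproduced: the case `1 < [k:k^p] < ∞` of (ii) (there the tower lives over `k₀ = k^{p^n} ≇ k`
inside `K`, and returning to the ground field `k` at the end uses that regular local rings are
normal — not yet in Mathlib); part (i) (the integral morphism `h`); the hypersurface form
`t^p = f(x)` of (iii) (a further "multiply `a` by a `p`-th power and localize" step on a chosen
regular model, which the weak predicate `IsLocallyUniformizable` does not expose).

Everything here is PROVED; the only named fact consumed is `Temkin2013` (Thm. 1.3.2, weak form),
taken as a hypothesis.
-/

noncomputable section

open IsLocalRing

namespace Literature.AlgebraicGeometry.Resolution

universe u

/-! ## Statements -/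

/-- **Local uniformization in characteristic `p` over PERFECT ground fields**: for every perfect
field `k` of characteristic `p`, every finitely generated extension `K/k` and every valuation ring
`O ⊇ k` of `K`, `O` is locally uniformizable over `k`. The restriction of
`LocalUniformizationInChar p` to perfect `k`; open for prime `p` in transcendence degree `≥ 4`.
[cite: Temkin2013, Section 1.3 (the local uniformization problem)] -/
def LocalUniformizationPerfectInChar (p : ℕ) : Prop :=
  ∀ (k K : Type u) [Field k] [CharP k p] [PerfectField k] [Field K] [Algebra k K],
    (⊤ : IntermediateField k K).FG →
    ∀ O : ValuationSubring K, (∀ c : k, algebraMap k K c ∈ O) → IsLocallyUniformizable k K O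

/-- **Local uniformization of valuations on `μ_p`-torsors** (the hypothesis of Temkin 2013,
Rem. 1.3.5 (ii): "if we know how to uniformize valuations on `μ_p`-torsors over regular schemes"),
field-theoretic rendering over perfect ground fields: for `k` perfect of characteristic `p`, a field
extension `K/k`, a valuation ring `O` of `K`, an intermediate field `K₀` and `a ∈ K` with
`a ^ p ∈ K₀` — if `O ∩ K₀` is locally uniformizable over `k` then so is `O ∩ K₀(a)`.
[cite: Temkin2013, Rem. 1.3.5 (ii)] -/
def MuPTorsorLocalUniformization (p : ℕ) : Prop :=
  ∀ (k K : Type u) [Field k] [CharP k p] [PerfectField k] [Field K] [Algebra k K]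
    (O : ValuationSubring K) (K₀ : IntermediateField k K) (a : K), a ^ p ∈ K₀ →
    IsLocallyUniformizable k K₀ (O.comap (algebraMap K₀ K)) →
    IsLocallyUniformizable k ↥(K₀ ⊔ IntermediateField.adjoin k {a})
      (O.comap (algebraMap ↥(K₀ ⊔ IntermediateField.adjoin k {a}) K))

/-- **The `μ_p`-torsor hypothesis at ONE ambient valuation ring** `O` of `K ⊇ k`: every torsor
step `K₀ ⊆ K₀(a)`, `a ^ p ∈ K₀`, inside `K` ascends local uniformization for the restrictions of
`O`. `MuPTorsorLocalUniformization p` is `∀ k K O, MuPTorsorStepsAt p k O` over perfect `k` of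
characteristic `p` (`muPTorsorLocalUniformization_iff_forall_stepsAt`); Temkin's induction
(Rem. 1.3.5 (ii): "Set `K°_i = K° ∩ K_i` … proceeding inductively") consumes exactly this, for the
one `K°` being uniformized. [cite: Temkin2013, Rem. 1.3.5 (ii)] -/
def MuPTorsorStepsAt (p : ℕ) (k : Type u) {K : Type u} [Field k] [Field K] [Algebra k K]
    (O : ValuationSubring K) : Prop :=
  ∀ (K₀ : IntermediateField k K) (a : K), a ^ p ∈ K₀ →
    IsLocallyUniformizable k K₀ (O.comap (algebraMap K₀ K)) →
    IsLocallyUniformizable k ↥(K₀ ⊔ IntermediateField.adjoin k {a})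
      (O.comap (algebraMap ↥(K₀ ⊔ IntermediateField.adjoin k {a}) K))

/-- `MuPTorsorLocalUniformization p` is the torsor hypothesis at every ambient valuation ring over
every perfect field of characteristic `p` (definitional). [folklore] -/
theorem muPTorsorLocalUniformization_iff_forall_stepsAt (p : ℕ) :
    MuPTorsorLocalUniformization.{u} p ↔
      ∀ (k K : Type u) [Field k] [CharP k p] [PerfectField k] [Field K] [Algebra k K]
        (O : ValuationSubring K), MuPTorsorStepsAt p k O :=
  Iff.rfl

/-! ## Transport of local uniformization along a semilinear field isomorphism -/

/-- **Transport of an affine model along a semilinear isomorphism of fields.** Let `e : L ≃ M` be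
a ring isomorphism of field extensions of `k` which is `σ`-semilinear for an automorphism `σ` of
`k` (`e (c • x) = σ c • e x`), and `O` a valuation ring of `M`. If `e⁻¹ O` is locally
uniformizable over `k`, so is `O`: the image of a finitely generated regular-at-the-centre model
is one. (For `σ = id` this is transport along a `k`-isomorphism.) [folklore] -/
theorem IsLocallyUniformizable.of_ringEquiv {k L M : Type u} [Field k] [Field L] [Field M]
    [Algebra k L] [Algebra k M] (e : L ≃+* M) (σ : k ≃+* k)
    (he : ∀ c : k, e (algebraMap k L c) = algebraMap k M (σ c)) (O : ValuationSubring M)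
    (h : IsLocallyUniformizable k L (O.comap (e : L →+* M))) :
    IsLocallyUniformizable k M O := by
  classical
  obtain ⟨A, hA, ⟨s, hs⟩, hfrac, hreg⟩ := h
  -- the image model `A₀ = e(A) = k[e(s)]`
  let s₀ : Finset M := s.image e
  let A₀ : Subalgebra k M := Algebra.adjoin k (s₀ : Set M)
  have hA₀fg : A₀.FG := Subalgebra.fg_adjoin_finset s₀
  have hrange : (e : L →+* M) '' Set.range (algebraMap k L) = Set.range (algebraMap k M) := by
    ext x
    constructor
    · rintro ⟨_, ⟨c, rfl⟩, rfl⟩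
      exact ⟨σ c, by rw [RingEquiv.coe_toRingHom, he]⟩
    · rintro ⟨c, rfl⟩
      exact ⟨algebraMap k L (σ.symm c), ⟨_, rfl⟩, by
        rw [RingEquiv.coe_toRingHom, he, RingEquiv.apply_symm_apply]⟩
  have hmapS : A.toSubring.map (e : L →+* M) = A₀.toSubring := by
    rw [← hs, Algebra.adjoin_eq_ring_closure, Algebra.adjoin_eq_ring_closure, RingHom.map_closure,
      Set.image_union, hrange]
    congr 2
    rw [Finset.coe_image, RingEquiv.coe_toRingHom]
  have hmemA₀ : ∀ {a : L}, a ∈ A → e a ∈ A₀ := by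
    intro a ha
    have : e a ∈ A.toSubring.map (e : L →+* M) := Subring.mem_map.mpr ⟨a, ha, rfl⟩
    rw [hmapS] at this
    exact this
  have hA₀O : A₀.toSubring ≤ O.toSubring := by
    intro x hx
    have hx' : x ∈ A.toSubring.map (e : L →+* M) := by rw [hmapS]; exact hx
    obtain ⟨a, ha, rfl⟩ := Subring.mem_map.mp hx'
    exact hA ha
  haveI := hfrac
  have hA₀fr : IsFractionRing A₀ M := by
    refine IsFractionRing.of_field A₀ M fun z => ?_
    obtain ⟨a, b, -, hab⟩ := IsFractionRing.div_surjective (A := A) (e.symm z)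
    refine ⟨⟨e a, hmemA₀ a.2⟩, ⟨e b, hmemA₀ b.2⟩, ?_⟩
    show z = e a / e b
    have hab' : (a : L) / b = e.symm z := hab
    rw [← map_div₀, hab', RingEquiv.apply_symm_apply]
  refine ⟨A₀, hA₀O, hA₀fg, hA₀fr, ?_⟩
  -- transport of the local ring at the centre along `A ≅ e(A) = A₀`
  let e' : A.toSubring ≃+* A₀.toSubring :=
    (A.toSubring.equivMapOfInjective (e : L →+* M) e.injective).trans
      (RingEquiv.subringCongr hmapS)
  have he' : ∀ a : A.toSubring, ((e' a : A₀.toSubring) : M) = e a := fun a => rfl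
  set P₀ : Ideal A₀.toSubring := Ideal.comap (Subring.inclusion hA₀O) (maximalIdeal O) with hP₀
  haveI hP₀p : P₀.IsPrime := Ideal.comap_isPrime _ _
  have hPe : P₀.comap (e' : A.toSubring →+* A₀.toSubring) =
      Ideal.comap (Subring.inclusion hA) (maximalIdeal (O.comap (e : L →+* M))) := by
    ext a
    have h2 : Subring.inclusion hA₀O (e' a) = ⟨e a, hA₀O (e' a).2⟩ := Subtype.ext (he' a)
    simp only [Ideal.mem_comap, hP₀, RingHom.coe_coe]
    rw [h2]
    exact (mk_mem_maximalIdeal_comap_iff O (e : L →+* M) (hA a.2)).symm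
  haveI : (P₀.comap (e' : A.toSubring →+* A₀.toSubring)).IsPrime := Ideal.comap_isPrime _ _
  exact (isRegularLocalRing_localization_iff_of_ringEquiv e' P₀).mpr
    (isRegularLocalRing_localization_atPrime_congr hPe.symm hreg)

/-! ## Finite generation bookkeeping -/

/-- A locally uniformizable valuation ring lives on a finitely generated extension: `K = k(s)` for
the generators `s` of a model `A` with `Frac A = K`. [folklore] -/
theorem IsLocallyUniformizable.fg_top {k K : Type u} [Field k] [Field K] [Algebra k K]
    {O : ValuationSubring K} (h : IsLocallyUniformizable k K O) :
    (⊤ : IntermediateField k K).FG := by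
  obtain ⟨A, -, ⟨s, hs⟩, hfrac, -⟩ := h
  refine ⟨s, eq_top_iff.mpr fun x _ => ?_⟩
  haveI := hfrac
  obtain ⟨a, b, -, rfl⟩ := IsFractionRing.div_surjective (A := A) x
  have hle : A ≤ (IntermediateField.adjoin k (s : Set K)).toSubalgebra := by
    rw [← hs]
    exact IntermediateField.algebra_adjoin_le_adjoin k _
  exact div_mem (hle a.2) (hle b.2)

/-- An intermediate field which is finitely generated "from inside" is finitely generated
(`IntermediateField.fg_top_iff`, `IntermediateField.essFiniteType_iff`). [folklore] -/
theorem intermediateField_fg_of_fg_top {k K : Type u} [Field k] [Field K] [Algebra k K]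
    (M : IntermediateField k K) (h : (⊤ : IntermediateField k M).FG) : M.FG :=
  IntermediateField.essFiniteType_iff.mp (IntermediateField.fg_top_iff.mp h)

/-! ## The easy directions -/

/-- Local uniformization in characteristic `p` restricts to perfect ground fields. [folklore] -/
theorem LocalUniformizationInChar.perfect {p : ℕ} (h : LocalUniformizationInChar.{u} p) :
    LocalUniformizationPerfectInChar.{u} p :=
  fun k K _ _ _ _ _ hfg O hk => h k K hfg O hk

/-- Local uniformization over perfect fields trivially contains its `μ_p`-torsor case (apply it
to the finitely generated field `K₀(a)`). [folklore] -/
theorem LocalUniformizationPerfectInChar.muPTorsor {p : ℕ}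
    (h : LocalUniformizationPerfectInChar.{u} p) : MuPTorsorLocalUniformization.{u} p := by
  intro k K _ _ _ _ _ O K₀ a _ hLU
  -- `k ⊆ O`, read off the model of `O ∩ K₀`
  have hk : ∀ c : k, algebraMap k K c ∈ O := by
    obtain ⟨A, hA, -, -, -⟩ := hLU
    intro c
    have h1 : algebraMap K₀ K (algebraMap k K₀ c) ∈ O := hA (A.algebraMap_mem c)
    rwa [← IsScalarTower.algebraMap_apply] at h1
  -- `K₀(a)` is finitely generated over `k`
  have hK₀fg : K₀.FG := intermediateField_fg_of_fg_top K₀ hLU.fg_top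
  have hMfg : (K₀ ⊔ IntermediateField.adjoin k {a}).FG :=
    IntermediateField.fg_sup hK₀fg (by
      simpa using IntermediateField.fg_adjoin_finset (F := k) ({a} : Finset K))
  exact h k _ (intermediateField_fg_top_of_fg _ hMfg) _ fun c => by
    show algebraMap _ K (algebraMap k _ c) ∈ O
    rw [← IsScalarTower.algebraMap_apply]
    exact hk c

/-! ## The tower: adjoining `p^n`-th roots one `p`-th root at a time -/

section Tower

variable {p : ℕ} {k K : Type u} [Field k] [CharP k p] [PerfectField k] [Field K] [Algebra k K]

omit [CharP k p] [PerfectField k] in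
/-- One generator: if `w ^ p ^ e ∈ M` and `O ∩ M` is uniformizable, so is `O ∩ M(w)` — induction on
`e` through `M ⊆ M(w^{p^{e-1}}) ⊆ … ⊆ M(w^p) ⊆ M(w)`, each step a `μ_p`-torsor step.
[cite: Temkin2013, Rem. 1.3.5 (ii)] -/
theorem muPTorsor_tower_simple_at (O : ValuationSubring K) (H : MuPTorsorStepsAt p k O) :
    ∀ (e : ℕ) (M : IntermediateField k K) (w : K), w ^ p ^ e ∈ M →
      IsLocallyUniformizable k M (O.comap (algebraMap M K)) →
      IsLocallyUniformizable k ↥(M ⊔ IntermediateField.adjoin k {w})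
        (O.comap (algebraMap ↥(M ⊔ IntermediateField.adjoin k {w}) K)) := by
  intro e
  induction e with
  | zero =>
    intro M w hw hM
    rw [pow_zero, pow_one] at hw
    have hMw : M ⊔ IntermediateField.adjoin k {w} = M :=
      sup_eq_left.mpr (IntermediateField.adjoin_simple_le_iff.mpr hw)
    rw [hMw]
    exact hM
  | succ e ih =>
    intro M w hw hM
    rw [pow_succ', pow_mul] at hw
    have h1 := ih M (w ^ p) hw hM
    have hwp : w ^ p ∈ M ⊔ IntermediateField.adjoin k {w ^ p} :=
      (le_sup_right : IntermediateField.adjoin k {w ^ p} ≤ M ⊔ IntermediateField.adjoin k {w ^ p})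
        (IntermediateField.mem_adjoin_simple_self k (w ^ p))
    have h2 := H (M ⊔ IntermediateField.adjoin k {w ^ p}) w hwp h1
    have heq : M ⊔ IntermediateField.adjoin k {w ^ p} ⊔ IntermediateField.adjoin k {w} =
        M ⊔ IntermediateField.adjoin k {w} := by
      rw [sup_assoc]
      congr 1
      exact sup_eq_right.mpr (IntermediateField.adjoin_simple_le_iff.mpr
        (pow_mem (IntermediateField.mem_adjoin_simple_self k w) p))
    rw [heq] at h2
    exact h2

omit [CharP k p] [PerfectField k] in
/-- Finitely many generators: if `g ^ p ^ n ∈ M` for all `g ∈ t` and `O ∩ M` is uniformizable, so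
is `O ∩ M(t)`. [cite: Temkin2013, Rem. 1.3.5 (ii)] -/
theorem muPTorsor_tower_at (O : ValuationSubring K) (H : MuPTorsorStepsAt p k O)
    (M : IntermediateField k K) (n : ℕ) (t : Finset K) (ht : ∀ g ∈ t, g ^ p ^ n ∈ M)
    (hM : IsLocallyUniformizable k M (O.comap (algebraMap M K))) :
    IsLocallyUniformizable k ↥(M ⊔ IntermediateField.adjoin k (t : Set K))
      (O.comap (algebraMap ↥(M ⊔ IntermediateField.adjoin k (t : Set K)) K)) := by
  classical
  induction t using Finset.induction_on with
  | empty =>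
    have hM0 : M ⊔ IntermediateField.adjoin k ((∅ : Finset K) : Set K) = M := by
      rw [Finset.coe_empty, IntermediateField.adjoin_empty, sup_bot_eq]
    rw [hM0]
    exact hM
  | insert g t hg ih =>
    have h1 := ih fun x hx => ht x (Finset.mem_insert_of_mem hx)
    have hgM : g ^ p ^ n ∈ M ⊔ IntermediateField.adjoin k (t : Set K) :=
      (le_sup_left : M ≤ M ⊔ IntermediateField.adjoin k (t : Set K))
        (ht g (Finset.mem_insert_self g t))
    have h2 := muPTorsor_tower_simple_at O H n _ g hgM h1
    have heq : M ⊔ IntermediateField.adjoin k (t : Set K) ⊔ IntermediateField.adjoin k {g} =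
        M ⊔ IntermediateField.adjoin k ((insert g t : Finset K) : Set K) := by
      rw [Finset.coe_insert, Set.insert_eq, IntermediateField.adjoin_union, sup_assoc,
        sup_comm (IntermediateField.adjoin k (t : Set K))]
    rw [heq] at h2
    exact h2

/-- `muPTorsor_tower_simple_at` under the global hypothesis `MuPTorsorLocalUniformization p`.
[cite: Temkin2013, Rem. 1.3.5 (ii)] -/
theorem muPTorsor_tower_simple (H : MuPTorsorLocalUniformization.{u} p) (O : ValuationSubring K) :
    ∀ (e : ℕ) (M : IntermediateField k K) (w : K), w ^ p ^ e ∈ M →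
      IsLocallyUniformizable k M (O.comap (algebraMap M K)) →
      IsLocallyUniformizable k ↥(M ⊔ IntermediateField.adjoin k {w})
        (O.comap (algebraMap ↥(M ⊔ IntermediateField.adjoin k {w}) K)) :=
  muPTorsor_tower_simple_at O (H k K O)

/-- `muPTorsor_tower_at` under the global hypothesis `MuPTorsorLocalUniformization p`.
[cite: Temkin2013, Rem. 1.3.5 (ii)] -/
theorem muPTorsor_tower (H : MuPTorsorLocalUniformization.{u} p) (O : ValuationSubring K)
    (M : IntermediateField k K) (n : ℕ) (t : Finset K) (ht : ∀ g ∈ t, g ^ p ^ n ∈ M)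
    (hM : IsLocallyUniformizable k M (O.comap (algebraMap M K))) :
    IsLocallyUniformizable k ↥(M ⊔ IntermediateField.adjoin k (t : Set K))
      (O.comap (algebraMap ↥(M ⊔ IntermediateField.adjoin k (t : Set K)) K)) :=
  muPTorsor_tower_at O (H k K O) M n t ht hM

end Tower

/-! ## The remark -/

/-- **Temkin 2013, Remark 1.3.5 (ii)–(iii), one valuation at a time, over a perfect ground
field: a valuation ring `O ⊇ k` of a finitely generated `K/k` all of whose `μ_p`-torsor steps
inside `K` ascend local uniformization (`MuPTorsorStepsAt p k O`) is locally uniformizable**,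
granted inseparable local uniformization (Thm. 1.3.2, `Temkin2013`). Proof as in the source: uniformize on Temkin's finite purely
inseparable `L/K`; the `n`-th Frobenius (`L^{p^n} ⊆ K`) is a field isomorphism `L ≅ K₀ := L^{p^n}`,
semilinear over the perfect field `k`, carrying `L°` to `O ∩ K₀`, so `O ∩ K₀` is uniformized; then
climb the purely inseparable tower `K₀ ⊆ … ⊆ K` by `p`-th roots.
[cite: Temkin2013, Rem. 1.3.5 (ii)-(iii) (arXiv:0804.1554v3 p. 4)] -/
theorem isLocallyUniformizable_of_muPTorsorStepsAt {p : ℕ} [hp : Fact p.Prime]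
    (hT : Temkin2013.{u}) {k K : Type u} [Field k] [CharP k p] [PerfectField k] [Field K]
    [Algebra k K] (hfg : (⊤ : IntermediateField k K).FG) (O : ValuationSubring K)
    (hk : ∀ c : k, algebraMap k K c ∈ O) (H : MuPTorsorStepsAt p k O) :
    IsLocallyUniformizable k K O := by
  classical
  obtain ⟨L, _, _, _, _, hfin, hpi, O', hO', hLU⟩ := hT k K hfg O hk
  haveI := hfin
  haveI := hpi
  haveI : CharP K p := charP_of_injective_algebraMap (algebraMap k K).injective p
  haveI : ExpChar K p := ExpChar.prime hp.out
  haveI : ExpChar k p := ExpChar.prime hp.out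
  -- `L^{p^n} ⊆ K`
  set n : ℕ := IsPurelyInseparable.exponent K L with hn
  let φ : L →+* K := IsPurelyInseparable.iterateFrobenius K L p le_rfl
  have hφL : ∀ x : L, algebraMap K L (φ x) = x ^ p ^ n := fun x =>
    IsPurelyInseparable.algebraMap_iterateFrobenius K p le_rfl x
  have hφK : ∀ a : K, φ (algebraMap K L a) = a ^ p ^ n := fun a =>
    IsPurelyInseparable.iterateFrobenius_algebraMap L p le_rfl a
  -- the `n`-th Frobenius of the perfect field `k`
  let σ : k ≃+* k := iterateFrobeniusEquiv k p n
  have hφk : ∀ c : k, φ (algebraMap k L c) = algebraMap k K (σ c) := by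
    intro c
    rw [IsScalarTower.algebraMap_apply k K L, hφK, iterateFrobeniusEquiv_def, map_pow]
  -- `K₀ = L^{p^n}`, an intermediate field of `K/k`
  let K₀ : IntermediateField k K := φ.fieldRange.toIntermediateField fun c =>
    RingHom.mem_fieldRange.mpr ⟨algebraMap k L (σ.symm c), by rw [hφk, RingEquiv.apply_symm_apply]⟩
  have hK₀ : ∀ x : K, x ∈ K₀ ↔ ∃ y, φ y = x := fun x => RingHom.mem_fieldRange
  -- the Frobenius isomorphism `e : L ≅ K₀`
  let φ₀ : L →+* K₀ := φ.codRestrict K₀ fun y => (hK₀ _).mpr ⟨y, rfl⟩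
  have hφ₀ : Function.Bijective φ₀ := by
    refine ⟨fun a b h => φ.injective (congrArg Subtype.val h :), fun x => ?_⟩
    obtain ⟨y, hy⟩ := (hK₀ x).mp x.2
    exact ⟨y, Subtype.ext hy⟩
  let e : L ≃+* K₀ := RingEquiv.ofBijective φ₀ hφ₀
  have he_val : ∀ y : L, ((e y : K₀) : K) = φ y := fun y => rfl
  have he : ∀ c : k, e (algebraMap k L c) = algebraMap k K₀ (σ c) := fun c =>
    Subtype.ext (by rw [he_val, hφk]; rfl)
  -- `e` carries `L° = O'` onto `O ∩ K₀`
  have hO'e : O' = (O.comap (algebraMap K₀ K)).comap (e : L →+* K₀) := by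
    ext x
    show x ∈ O' ↔ φ x ∈ O
    rw [← hO', ValuationSubring.mem_comap, hφL]
    exact ⟨fun h => pow_mem h _,
      fun h => mem_valuationSubring_of_pow_mem O' (pow_pos hp.out.pos n) h⟩
  have hLU₀ : IsLocallyUniformizable k K₀ (O.comap (algebraMap K₀ K)) := by
    rw [hO'e] at hLU
    exact IsLocallyUniformizable.of_ringEquiv e σ he _ hLU
  -- climb the tower `K₀ ⊆ K₀(t₁) ⊆ … ⊆ K₀(t₁, …, t_m) = K`
  obtain ⟨t, ht⟩ := hfg
  have hgen : ∀ g ∈ t, g ^ p ^ n ∈ K₀ := fun g _ => (hK₀ _).mpr ⟨algebraMap K L g, hφK g⟩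
  have htop := muPTorsor_tower_at O H K₀ n t hgen hLU₀
  rw [ht, sup_top_eq] at htop
  -- and come back from `⊤ ≤ K` to `K`
  let e' : (⊤ : IntermediateField k K) ≃+* K :=
    (IntermediateField.topEquiv (F := k) (E := K)).toRingEquiv
  have hcomap : O.comap (e' : (⊤ : IntermediateField k K) →+* K) =
      O.comap (algebraMap (⊤ : IntermediateField k K) K) := by
    ext x; rfl
  refine IsLocallyUniformizable.of_ringEquiv e' (RingEquiv.refl k) (fun c => ?_) O ?_
  · exact (IntermediateField.topEquiv (F := k) (E := K)).commutes c
  · rw [hcomap]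
    exact htop

/-- **Temkin 2013, Remark 1.3.5 (ii)–(iii), over perfect ground fields: local uniformization
follows from inseparable local uniformization (Thm. 1.3.2) and local uniformization of valuations
on `μ_p`-torsors.** For a prime `p`: `Temkin2013 → MuPTorsorLocalUniformization p →
LocalUniformizationPerfectInChar p` (`isLocallyUniformizable_of_muPTorsorStepsAt` at every `O`).
[cite: Temkin2013, Rem. 1.3.5 (ii)-(iii) (arXiv:0804.1554v3 p. 4)] -/
theorem MuPTorsorLocalUniformization.localUniformizationPerfect {p : ℕ} [Fact p.Prime]
    (hT : Temkin2013.{u}) (H : MuPTorsorLocalUniformization.{u} p) :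
    LocalUniformizationPerfectInChar.{u} p :=
  fun k K _ _ _ _ _ hfg O hk => isLocallyUniformizable_of_muPTorsorStepsAt hT hfg O hk (H k K O)

/-- **Over perfect fields, local uniformization is equivalent to its `μ_p`-torsor case**, granted
Temkin's inseparable local uniformization. [cite: Temkin2013, Rem. 1.3.5 (ii)-(iii)] -/
theorem localUniformizationPerfectInChar_iff {p : ℕ} [Fact p.Prime] (hT : Temkin2013.{u}) :
    LocalUniformizationPerfectInChar.{u} p ↔ MuPTorsorLocalUniformization.{u} p :=
  ⟨LocalUniformizationPerfectInChar.muPTorsor, fun H => H.localUniformizationPerfect hT⟩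

/-- **The `μ_p`-torsor hypothesis is only needed at valuations of positive transcendence
defect.** Over perfect fields of characteristic `p` (prime), granted `Temkin2013`: local
uniformization holds iff every valuation ring `O ⊇ k` of POSITIVE transcendence defect
(`E + F < tr.deg`, Temkin §2.1) on a finitely generated `K/k` satisfies `MuPTorsorStepsAt p k O`.
The Abhyankar valuations (`E + F = tr.deg`) are uniformized outright by Knaf–Kuhlmann 2005,
Thm. 1.1 (`isLocallyUniformizable_of_transcendenceDefect_eq_zero`), and a torsor step does not
change `E`, `F` or `tr.deg` (finite extension), so the open core of local uniformization over
perfect fields is: torsor steps `K₀ ⊆ K₀(a^{1/p})` under ONE valuation of positive transcendence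
defect, in transcendence degree `≥ 4`. [cite: Temkin2013, Rem. 1.3.5 (ii)-(iii)]
[cite: KnafKuhlmann2005, Thm. 1.1] -/
theorem localUniformizationPerfectInChar_iff_posDefect {p : ℕ} [Fact p.Prime]
    (hT : Temkin2013.{u}) :
    LocalUniformizationPerfectInChar.{u} p ↔
      ∀ (k K : Type u) [Field k] [CharP k p] [PerfectField k] [Field K] [Algebra k K],
        (⊤ : IntermediateField k K).FG →
        ∀ (O : ValuationSubring K) (hk : ∀ c : k, algebraMap k K c ∈ O),
          transcendenceDefect k O hk ≠ 0 → MuPTorsorStepsAt p k O := by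
  refine ⟨fun h k K _ _ _ _ _ _ O _ _ => h.muPTorsor k K O, fun h k K _ _ _ _ _ hfg O hk => ?_⟩
  by_cases h0 : transcendenceDefect k O hk = 0
  · exact isLocallyUniformizable_of_transcendenceDefect_eq_zero hfg O hk h0
  · exact isLocallyUniformizable_of_muPTorsorStepsAt hT hfg O hk (h k K hfg O hk h0)

end Literature.AlgebraicGeometry.Resolution

end
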